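import Summits.BirchSwinnertonDyer.BirchSwinnertonDyer.Theses.DerivedKatoValuationDoor

/-!
# BirchSwinnertonDyer / DerivedKatoValuationDoor — crux `DerivedKatoDoor` (stmt-BirchSwinnertonDyer-23024):
# negative lemmas (standing disprover, cycle 1)

Load-bearing analysis of the crux
`∀ W [IsElliptic] [IsGloballyMinimal] p …, W.analyticRank = 2 → (5 ≤ p ∧ IsOrdinaryAt W p ∧
W.HasSurjectiveModNGaloisRep p) → ∀ K hK γ I z₀, K.IsTopGenerator γ → IsAdmissibleZetaClass W p K hK I z₀ →
¬ ∃ h m, p^m • z₀ = X² • h` (D-K₂: `v_T(z₀) ≤ 1` at door primes of analytic-rank-two curves), as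
kernel-checked implications over the route's PINNED decls.  No statement of the route is asserted
positively; nothing here refutes the crux (every `H` below is print-true-but-unconstructible or
BSD-violating).  Notation: `s` = `ℤ_p`-rank of the strict part of `H¹(ℤ[1/S], T_pE)` (integral classes
with `locModPk = 0 ∀ k`), `v = v_T(z₀)`; PRINT gives `v ≥ s` (Kato's divisibility + `𝐇² ↠ H²(ℤ_S,T)_tf`,
the proof of Burns–Kurihara–Sano Prop. 4.5), which is the route's support P1 `StrictRankLeDerivedOrder`
at `s = 2` and (★₀) below at `s = 1`.

* `derivedKatoDoor_false_of_strictIndependentPair` — KILL CRITERION (K-i): P1 + one `a = 2` curve with a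
  door prime, an admissible class and two independent strict classes ⇒ ¬ crux (`s ≥ 2`, i.e. `s_p ≥ 3`:
  BSD-violating; the E-S0-1 atlas has no such cell among 21 680).
* `derivedKatoDoor_fromTwo_false_of_strictIndependentPair` — the hypothesis `W.analyticRank = 2` is
  LOAD-BEARING: the mutant with `2 ≤ W.analyticRank` is false modulo the same `H`, and print supplies `H`
  at `a = 3` (5077a: three points ⇒ `s ≥ 2` unconditionally).
* `derivedKatoDoor_strongZero_false_of` — the exponent `2` is TIGHT: «`v = 0` at `a = 2`» (exponent `1`)
  is false modulo (★₀) + one rank-two instance with a non-torsion strict class (print: every rank-two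
  curve, e.g. (389a1, 5)).
* `derivedKatoDoor_false_of_fineLength_two` — KILL CRITERION (K-ii), the BSD-CONSISTENT one: modulo
  Kato's divisibility at `(T)` and `T`-saturation of `𝐇¹`, one `a = 2` door cell with `2 ≤ ℓ_T(X₀(E/ℚ_∞))`
  (a `T²`-Jordan block in the dual fine Selmer group = failure of Greenberg's semisimplicity conjecture,
  Kurihara–Pollack Problem 0.7; Lim 2022 Conj. 4.2) ⇒ ¬ crux.  This is the crux's genuine open content.
* `derivedKatoDoor_false_of_admissible_zero` — the one definitional lever (`z₀ = 0`), fenced in the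
  tree by `IsAdmissibleZetaClass.ne_zero_of_forall_not_dvd_level`.
* `derivedKatoDoor_lowerL3_false_of_fineLength_two`, `derivedKatoDoor_not_lowerL3_of_not` — the picked
  line `lower`: its open stub L3 (`ℓ_T(X₀) ≤ 1`) is killed by exactly (K-ii), and is NECESSARY for the
  line given its algebra and print stubs (L3 ≡ crux modulo print; no gap, no excess).

Dropping «good ordinary», «ρ̄ onto» or «5 ≤ p» produces NO counterexample mechanism for the valuation
claim (see `Cruxes/DerivedKatoDoor/Disproof.lean` for the full record, the atlas reading `A = v + w`,
and the literature placement).  BSD is not proved by any of this.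
-/

set_option linter.dupNamespace false

noncomputable section

namespace Summit.BirchSwinnertonDyer.BirchSwinnertonDyer.Theorems

open Literature Literature.NumberTheory.GaloisRepresentations
open Literature.NumberTheory.EllipticCurves Literature.NumberTheory.EllipticCurves.Kato2004
open Literature.NumberTheory.EllipticCurves.Kato2004.EulerSystemValues
open Summit.BirchSwinnertonDyer.BirchSwinnertonDyer.Theses.DerivedKatoValuationDoor

/-- **KILL CRITERION (K-i), typed through the route's own support P1 (`StrictRankLeDerivedOrder`, the
contrapositive of Burns–Kurihara–Sano Prop. 4.5):** an analytic-rank-two curve with a door prime `p`,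
an admissible Kato zeta class, and TWO `ℤ_p`-INDEPENDENT strict classes (integral, `locModPk = 0 ∀ k`)
refutes the crux.  At `a = 2` one rational point already makes the strict rank `s_p − 1`, so this `H`
says `s_p ≥ 3` — it violates BSD (+ finiteness of `Ш[p^∞]`) and is the failure mode the E-S0-1 atlas
watches (`A > 2`: 0 of 21 680 certified cells, j314427).  Settles nothing.
[cite: BurnsKuriharaSano2019, Prop. 4.5] -/
theorem derivedKatoDoor_false_of_strictIndependentPair (hP1 : StrictRankLeDerivedOrder)
    (W : WeierstrassCurve ℚ) [W.IsElliptic] [W.IsGloballyMinimal] (p : ℕ) [Fact p.Prime]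
    [ContinuousSMul ℤ_[p] (W.tateModule p)] (ha : W.analyticRank = 2)
    (hdoor : 5 ≤ p ∧ IsOrdinaryAt W p ∧ W.HasSurjectiveModNGaloisRep p)
    (hadm : ∃ (K : ZpExtension ℚ p) (hK : K.IsCyclotomic) (γ : Field.absoluteGaloisGroup ℚ)
      (I : IwasawaH1Data W p K γ) (z₀ : I.H), K.IsTopGenerator γ ∧ IsAdmissibleZetaClass W p K hK I z₀)
    (x y : H1 (tateRep W p) ⊤) (hx : x ∈ integralH1 (tateRep W p) p ⊤)
    (hy : y ∈ integralH1 (tateRep W p) p ⊤) (hx0 : ∀ k : ℕ, locModPk W p k x = 0)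
    (hy0 : ∀ k : ℕ, locModPk W p k y = 0) (hind : ∀ a b : ℤ_[p], a • x + b • y = 0 → a = 0 ∧ b = 0) :
    ¬ DerivedKatoDoor := by
  intro hD
  obtain ⟨K, hK, γ, I, z₀, hγ, hz⟩ := hadm
  obtain ⟨a, b, hab, h0⟩ :=
    hP1 W p hdoor ⟨K, hK, γ, I, z₀, hγ, hz, hD W p ha hdoor K hK γ I z₀ hγ hz⟩ x y hx hy hx0 hy0
  obtain ⟨rfl, rfl⟩ := hind a b h0
  exact hab.elim (fun h => h rfl) (fun h => h rfl)

/-- **`W.analyticRank = 2` is LOAD-BEARING — the mutant «`2 ≤ W.analyticRank`» is false modulo `H`** =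
P1 + ONE curve of analytic rank `≥ 2` with a door prime, an admissible class and two independent strict
classes.  Print supplies `H` at `a = 3`: 5077a (prime conductor, no isogeny, `a_5 = a_7 = −4` ordinary)
has three independent points, so the strict part — the kernel of `E(ℚ) ⊗ ℤ_p → E(ℚ_p) ⊗̂ ℤ_p ≅ ℤ_p ⊕`
finite on a rank-3 lattice — has rank `≥ 2` UNCONDITIONALLY; analytic rank `3` is Buhler–Gross–Zagier.
So the `a ≥ 2` version is false in print (`v ≥ 2` there), while `H` is not constructible in the tree
(analytic rank; admissible realisability).  Any proof of the crux must use `a = 2`, not `a ≥ 2`.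
[cite: BurnsKuriharaSano2019, Prop. 4.5] -/
theorem derivedKatoDoor_fromTwo_false_of_strictIndependentPair (hP1 : StrictRankLeDerivedOrder)
    (W : WeierstrassCurve ℚ) [W.IsElliptic] [W.IsGloballyMinimal] (p : ℕ) [Fact p.Prime]
    [ContinuousSMul ℤ_[p] (W.tateModule p)] (ha : 2 ≤ W.analyticRank)
    (hdoor : 5 ≤ p ∧ IsOrdinaryAt W p ∧ W.HasSurjectiveModNGaloisRep p)
    (hadm : ∃ (K : ZpExtension ℚ p) (hK : K.IsCyclotomic) (γ : Field.absoluteGaloisGroup ℚ)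
      (I : IwasawaH1Data W p K γ) (z₀ : I.H), K.IsTopGenerator γ ∧ IsAdmissibleZetaClass W p K hK I z₀)
    (x y : H1 (tateRep W p) ⊤) (hx : x ∈ integralH1 (tateRep W p) p ⊤)
    (hy : y ∈ integralH1 (tateRep W p) p ⊤) (hx0 : ∀ k : ℕ, locModPk W p k x = 0)
    (hy0 : ∀ k : ℕ, locModPk W p k y = 0) (hind : ∀ a b : ℤ_[p], a • x + b • y = 0 → a = 0 ∧ b = 0) :
    ¬ (∀ (W : WeierstrassCurve ℚ) [W.IsElliptic] [W.IsGloballyMinimal] (p : ℕ) [Fact p.Prime]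
        [ContinuousSMul ℤ_[p] (W.tateModule p)], 2 ≤ W.analyticRank →
        (5 ≤ p ∧ IsOrdinaryAt W p ∧ W.HasSurjectiveModNGaloisRep p) →
        ∀ (K : ZpExtension ℚ p) (hK : K.IsCyclotomic) (γ : Field.absoluteGaloisGroup ℚ)
          (I : IwasawaH1Data W p K γ) (z₀ : I.H), K.IsTopGenerator γ →
          IsAdmissibleZetaClass W p K hK I z₀ →
          ¬ ∃ (h : I.H) (m : ℕ),
            ((p : IwasawaAlgebra p) ^ m) • z₀ = ((PowerSeries.X : IwasawaAlgebra p) ^ 2) • h) := by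
  intro hD
  obtain ⟨K, hK, γ, I, z₀, hγ, hz⟩ := hadm
  obtain ⟨a, b, hab, h0⟩ :=
    hP1 W p hdoor ⟨K, hK, γ, I, z₀, hγ, hz, hD W p ha hdoor K hK γ I z₀ hγ hz⟩ x y hx hy hx0 hy0
  obtain ⟨rfl, rfl⟩ := hind a b h0
  exact hab.elim (fun h => h rfl) (fun h => h rfl)

/-- **The exponent `2` is TIGHT — «`v = 0` at `a = 2`» (exponent `1`) is false modulo `H`** = (★₀)
[one admissible class with `v_T = 0` at a door prime forces the strict part to be torsion: Kato's
divisibility + `𝐇² ↠ H²(ℤ_S, T)_tf`, the proof of Burns–Kurihara–Sano Prop. 4.5 one notch lower] + ONE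
analytic-rank-two curve with a door prime, an admissible class and ONE non-torsion strict class.  Print
supplies the instance at every rank-two curve (two points ⇒ strict rank `≥ 1` unconditionally; e.g.
(389a1, 5): `a_5 = −3`, image maximal, analytic rank exactly `2`), so the exponent-`1` version is false
in print — `v_T(z₀) ≥ 1` always at `a = 2` (Kurihara–Pollack Prop. 3.1: `char ⊂ (∏ Φ_n^{e_n−1})`).
[cite: BurnsKuriharaSano2019, Prop. 4.5] [cite: KuriharaPollack2007, §3.1 Prop. 3.1] -/
theorem derivedKatoDoor_strongZero_false_of
    (hStar0 : ∀ (W : WeierstrassCurve ℚ) [W.IsElliptic] [W.IsGloballyMinimal] (p : ℕ) [Fact p.Prime]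
      [ContinuousSMul ℤ_[p] (W.tateModule p)],
      (5 ≤ p ∧ IsOrdinaryAt W p ∧ W.HasSurjectiveModNGaloisRep p) →
      (∃ (K : ZpExtension ℚ p) (hK : K.IsCyclotomic) (γ : Field.absoluteGaloisGroup ℚ)
        (I : IwasawaH1Data W p K γ) (z₀ : I.H), K.IsTopGenerator γ ∧ IsAdmissibleZetaClass W p K hK I z₀ ∧
        ¬ ∃ (h : I.H) (m : ℕ),
          ((p : IwasawaAlgebra p) ^ m) • z₀ = ((PowerSeries.X : IwasawaAlgebra p) ^ 1) • h) →
      ∀ x : H1 (tateRep W p) ⊤, x ∈ integralH1 (tateRep W p) p ⊤ → (∀ k : ℕ, locModPk W p k x = 0) →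
        ∃ a : ℤ_[p], a ≠ 0 ∧ a • x = 0)
    (W : WeierstrassCurve ℚ) [W.IsElliptic] [W.IsGloballyMinimal] (p : ℕ) [Fact p.Prime]
    [ContinuousSMul ℤ_[p] (W.tateModule p)] (ha : W.analyticRank = 2)
    (hdoor : 5 ≤ p ∧ IsOrdinaryAt W p ∧ W.HasSurjectiveModNGaloisRep p)
    (hadm : ∃ (K : ZpExtension ℚ p) (hK : K.IsCyclotomic) (γ : Field.absoluteGaloisGroup ℚ)
      (I : IwasawaH1Data W p K γ) (z₀ : I.H), K.IsTopGenerator γ ∧ IsAdmissibleZetaClass W p K hK I z₀)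
    (x : H1 (tateRep W p) ⊤) (hx : x ∈ integralH1 (tateRep W p) p ⊤)
    (hx0 : ∀ k : ℕ, locModPk W p k x = 0) (hfree : ∀ a : ℤ_[p], a • x = 0 → a = 0) :
    ¬ (∀ (W : WeierstrassCurve ℚ) [W.IsElliptic] [W.IsGloballyMinimal] (p : ℕ) [Fact p.Prime]
        [ContinuousSMul ℤ_[p] (W.tateModule p)], W.analyticRank = 2 →
        (5 ≤ p ∧ IsOrdinaryAt W p ∧ W.HasSurjectiveModNGaloisRep p) →
        ∀ (K : ZpExtension ℚ p) (hK : K.IsCyclotomic) (γ : Field.absoluteGaloisGroup ℚ)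
          (I : IwasawaH1Data W p K γ) (z₀ : I.H), K.IsTopGenerator γ →
          IsAdmissibleZetaClass W p K hK I z₀ →
          ¬ ∃ (h : I.H) (m : ℕ),
            ((p : IwasawaAlgebra p) ^ m) • z₀ = ((PowerSeries.X : IwasawaAlgebra p) ^ 1) • h) := by
  intro hD
  obtain ⟨K, hK, γ, I, z₀, hγ, hz⟩ := hadm
  obtain ⟨a, ha0, hax⟩ :=
    hStar0 W p hdoor ⟨K, hK, γ, I, z₀, hγ, hz, hD W p ha hdoor K hK γ I z₀ hγ hz⟩ x hx hx0
  exact ha0 (hfree a hax)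

/-- **KILL CRITERION (K-ii) — the BSD-CONSISTENT one.**  Hypotheses: (1) Kato's divisibility at the
height-one prime `(T)` — PROVED in print: at a door prime, for every admissible `z₀`,
`ℓ_T(X₀(E/ℚ_∞)) ≤ ℓ_T(𝐇¹/Λz₀)` (Kato Thm. 12.5 (4)/17.4 `char 𝐇² ⊇ char(𝐇¹/Z)` under big image;
`Z_(T) = Λ_(T) z₀`; `X₀ ↪ 𝐇²` with finite cokernel by Poitou–Tate); (2) `T`-saturation — algebra
modulo Kato Thm. 12.4 (3) (`𝐇¹ = Λc` free of rank one at a door prime, `z₀ = f c`,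
`ℓ_T(𝐇¹/Λz₀) = ord_T f`, `T² ∣ p^m f ⟺ T² ∣ f`): `2 ≤ ℓ_T(𝐇¹/Λz₀) ⇒ ∃ m h, p^m z₀ = T² h`.  Then ONE
analytic-rank-two curve with a door prime, a cyclotomic datum with `2 ≤ ℓ_T(X₀(E/ℚ_∞))` and an
admissible class refutes the crux.  Under BSD the `T`-part of `X₀` is a single block (`rank X₀/TX₀ = s =
1`), so `2 ≤ ℓ_T(X₀)` is a block `Λ/T^e`, `e ≥ 2`: a failure of Greenberg's semisimplicity conjecture
for the fine Selmer dual (Kurihara–Pollack Problem 0.7 / Problem 3.2; Lim 2022 Conj. 4.2, "very little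
evidence in literature").  No example is in print; the atlas reading `A = v + w` certifies `v = 1` in
every E-S0-1 cell.  Settles nothing; this is the crux's open content.
[cite: Kato2004Asterisque, Thm. 12.4 (3) (p. 221), Thm. 12.5 (4) (p. 222), Conj. 12.10 (p. 224), §17.13 (p. 279)]
[cite: KuriharaPollack2007, Problem 0.7 and §3.1 Problem 3.2] [cite: Lim2022OrderVanishing, Conj. 4.2 and Lemma 4.4] -/
theorem derivedKatoDoor_false_of_fineLength_two
    (hdiv : ∀ (W : WeierstrassCurve ℚ) [W.IsElliptic] [W.IsGloballyMinimal] (p : ℕ) [Fact p.Prime]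
      [ContinuousSMul ℤ_[p] (W.tateModule p)],
      (5 ≤ p ∧ IsOrdinaryAt W p ∧ W.HasSurjectiveModNGaloisRep p) →
      ∀ (K : ZpExtension ℚ p) (hK : K.IsCyclotomic) (γ : Field.absoluteGaloisGroup ℚ)
        (I : IwasawaH1Data W p K γ) (z₀ : I.H) (hγ : K.IsTopGenerator γ),
        IsAdmissibleZetaClass W p K hK I z₀ →
          Module.lengthAt (IwasawaAlgebra p) (W.fineSelmerDualData K hγ).X (IwasawaAlgebra.primeT p) ≤
            Module.lengthAt (IwasawaAlgebra p) (I.H ⧸ Submodule.span (IwasawaAlgebra p) {z₀})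
              (IwasawaAlgebra.primeT p))
    (hsat : ∀ (W : WeierstrassCurve ℚ) [W.IsElliptic] [W.IsGloballyMinimal] (p : ℕ) [Fact p.Prime]
      [ContinuousSMul ℤ_[p] (W.tateModule p)],
      (5 ≤ p ∧ IsOrdinaryAt W p ∧ W.HasSurjectiveModNGaloisRep p) →
      ∀ (K : ZpExtension ℚ p), K.IsCyclotomic → ∀ (γ : Field.absoluteGaloisGroup ℚ)
        (I : IwasawaH1Data W p K γ) (z₀ : I.H), K.IsTopGenerator γ →
        (2 : ℕ∞) ≤ Module.lengthAt (IwasawaAlgebra p) (I.H ⧸ Submodule.span (IwasawaAlgebra p) {z₀})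
            (IwasawaAlgebra.primeT p) →
          ∃ (h : I.H) (m : ℕ),
            ((p : IwasawaAlgebra p) ^ m) • z₀ = ((PowerSeries.X : IwasawaAlgebra p) ^ 2) • h)
    (W : WeierstrassCurve ℚ) [W.IsElliptic] [W.IsGloballyMinimal] (p : ℕ) [Fact p.Prime]
    [ContinuousSMul ℤ_[p] (W.tateModule p)] (ha : W.analyticRank = 2)
    (hdoor : 5 ≤ p ∧ IsOrdinaryAt W p ∧ W.HasSurjectiveModNGaloisRep p)
    (K : ZpExtension ℚ p) (hK : K.IsCyclotomic) (γ : Field.absoluteGaloisGroup ℚ)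
    (hγ : K.IsTopGenerator γ)
    (hX : (2 : ℕ∞) ≤
      Module.lengthAt (IwasawaAlgebra p) (W.fineSelmerDualData K hγ).X (IwasawaAlgebra.primeT p))
    (hadm : ∃ (I : IwasawaH1Data W p K γ) (z₀ : I.H), IsAdmissibleZetaClass W p K hK I z₀) :
    ¬ DerivedKatoDoor := by
  intro hD
  obtain ⟨I, z₀, hz⟩ := hadm
  exact hD W p ha hdoor K hK γ I z₀ hγ hz
    (hsat W p hdoor K hK γ I z₀ hγ (hX.trans (hdiv W p hdoor K hK γ I z₀ hγ hz)))

/-- **The one definitional lever: `z₀ = 0`** satisfies `p^0 • 0 = T² • 0`, so an `a = 2` door cell at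
which `0` were admissible would refute the crux — equivalently the crux CONTAINS Kato's non-vanishing of
admissible classes there.  Fenced in the tree: `IsAdmissibleZetaClass.ne_zero_of_forall_not_dvd_level`
(Rohrlich) gives `z₀ ≠ 0` whenever `p ∤ level`, which good reduction at `p` supplies.  Settles nothing.
[cite: Kato2004Asterisque, Thm. 12.5 (pp. 221–222)] -/
theorem derivedKatoDoor_false_of_admissible_zero (W : WeierstrassCurve ℚ) [W.IsElliptic]
    [W.IsGloballyMinimal] (p : ℕ) [Fact p.Prime] [ContinuousSMul ℤ_[p] (W.tateModule p)]
    (ha : W.analyticRank = 2) (hdoor : 5 ≤ p ∧ IsOrdinaryAt W p ∧ W.HasSurjectiveModNGaloisRep p)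
    (K : ZpExtension ℚ p) (hK : K.IsCyclotomic) (γ : Field.absoluteGaloisGroup ℚ)
    (I : IwasawaH1Data W p K γ) (hγ : K.IsTopGenerator γ) (h0 : IsAdmissibleZetaClass W p K hK I 0) :
    ¬ DerivedKatoDoor := fun hD =>
  hD W p ha hdoor K hK γ I 0 hγ h0 ⟨0, 0, by rw [smul_zero, smul_zero]⟩

/-- **Line `lower` (PICKED), target L3 `stub_fineLengthLeOneOfAnalyticRankTwo` (`ℓ_T(X₀) ≤ 1` at door
primes of analytic-rank-two curves, `Cruxes/DerivedKatoDoor/Lines/lower.lean`): what kills it is (K-ii)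
verbatim, with no further hypothesis** — one `a = 2` door cell and a cyclotomic datum with
`2 ≤ ℓ_T(X₀(E/ℚ_∞))` (a `T²`-block or two `T`-blocks in the fine Selmer dual).  Neither constructible
(analytic rank) nor in print.  Settles nothing. [cite: KuriharaPollack2007, Problem 0.7]
[cite: Lim2022OrderVanishing, Conj. 4.2] -/
theorem derivedKatoDoor_lowerL3_false_of_fineLength_two (W : WeierstrassCurve ℚ) [W.IsElliptic]
    [W.IsGloballyMinimal] (p : ℕ) [Fact p.Prime] [ContinuousSMul ℤ_[p] (W.tateModule p)]
    (ha : W.analyticRank = 2) (hdoor : 5 ≤ p ∧ IsOrdinaryAt W p ∧ W.HasSurjectiveModNGaloisRep p)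
    (K : ZpExtension ℚ p) (hK : K.IsCyclotomic) (γ : Field.absoluteGaloisGroup ℚ)
    (hγ : K.IsTopGenerator γ)
    (hX : (2 : ℕ∞) ≤
      Module.lengthAt (IwasawaAlgebra p) (W.fineSelmerDualData K hγ).X (IwasawaAlgebra.primeT p)) :
    ¬ (∀ (W : WeierstrassCurve ℚ) [W.IsElliptic] [W.IsGloballyMinimal] (p : ℕ) [Fact p.Prime]
        [ContinuousSMul ℤ_[p] (W.tateModule p)], W.analyticRank = 2 →
        (5 ≤ p ∧ IsOrdinaryAt W p ∧ W.HasSurjectiveModNGaloisRep p) →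
        ∀ (K : ZpExtension ℚ p), K.IsCyclotomic →
          ∀ (γ : Field.absoluteGaloisGroup ℚ) (hγ : K.IsTopGenerator γ),
            Module.lengthAt (IwasawaAlgebra p) (W.fineSelmerDualData K hγ).X
              (IwasawaAlgebra.primeT p) ≤ 1) := fun hL3 => by
  have h21 : (2 : ℕ∞) ≤ 1 := hX.trans (hL3 W p ha hdoor K hK γ hγ)
  exact absurd h21 (by decide)

/-- **Line `lower`, joint sufficiency read backwards (no gap smuggled by its composition):** given the
algebra stub L1 (`p^m z₀ ∈ T^k 𝐇¹`, `z₀ ≠ 0` ⇒ `k ≤ ℓ_T(𝐇¹/Λz₀)`) and the print stub L2 (`z₀ ≠ 0` and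
`ℓ_T(𝐇¹/Λz₀) ≤ ℓ_T(X₀)` at door primes: BCS 2024 cyclotomic IMC + Kato §17.13), a kill of the crux kills
the open stub L3 — L3 is NECESSARY for the line modulo its own imports; with
`derivedKatoDoor_false_of_fineLength_two` (L3-kill ⇒ crux-kill modulo Kato's divisibility, saturation,
P-a) the open stub is EQUIVALENT to the crux modulo print: the line neither loses nor adds open content.
[cite: Kato2004Asterisque, Conj. 12.10 (p. 224), §17.13 (p. 279)] [cite: BurungaleCastellaSkinner2024, Thm. 1.1.2] -/
theorem derivedKatoDoor_not_lowerL3_of_not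
    (hL1 : ∀ (W : WeierstrassCurve ℚ) [W.IsElliptic] (p : ℕ) [Fact p.Prime]
      [ContinuousSMul ℤ_[p] (W.tateModule p)]
      (K : ZpExtension ℚ p) (γ : Field.absoluteGaloisGroup ℚ) (I : IwasawaH1Data W p K γ) (z₀ : I.H),
      K.IsTopGenerator γ → z₀ ≠ 0 → ∀ k : ℕ,
      (∃ (h : I.H) (m : ℕ),
        ((p : IwasawaAlgebra p) ^ m) • z₀ = ((PowerSeries.X : IwasawaAlgebra p) ^ k) • h) →
      (k : ℕ∞) ≤ Module.lengthAt (IwasawaAlgebra p) (I.H ⧸ Submodule.span (IwasawaAlgebra p) {z₀})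
        (IwasawaAlgebra.primeT p))
    (hL2 : ∀ (W : WeierstrassCurve ℚ) [W.IsElliptic] [W.IsGloballyMinimal] (p : ℕ) [Fact p.Prime]
      [ContinuousSMul ℤ_[p] (W.tateModule p)],
      (5 ≤ p ∧ IsOrdinaryAt W p ∧ W.HasSurjectiveModNGaloisRep p) →
      ∀ (K : ZpExtension ℚ p) (hK : K.IsCyclotomic) (γ : Field.absoluteGaloisGroup ℚ)
        (I : IwasawaH1Data W p K γ) (z₀ : I.H) (hγ : K.IsTopGenerator γ),
        IsAdmissibleZetaClass W p K hK I z₀ →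
        z₀ ≠ 0 ∧
          Module.lengthAt (IwasawaAlgebra p) (I.H ⧸ Submodule.span (IwasawaAlgebra p) {z₀})
              (IwasawaAlgebra.primeT p) ≤
            Module.lengthAt (IwasawaAlgebra p) (W.fineSelmerDualData K hγ).X (IwasawaAlgebra.primeT p))
    (hD : ¬ DerivedKatoDoor) :
    ¬ (∀ (W : WeierstrassCurve ℚ) [W.IsElliptic] [W.IsGloballyMinimal] (p : ℕ) [Fact p.Prime]
        [ContinuousSMul ℤ_[p] (W.tateModule p)], W.analyticRank = 2 →
        (5 ≤ p ∧ IsOrdinaryAt W p ∧ W.HasSurjectiveModNGaloisRep p) →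
        ∀ (K : ZpExtension ℚ p), K.IsCyclotomic →
          ∀ (γ : Field.absoluteGaloisGroup ℚ) (hγ : K.IsTopGenerator γ),
            Module.lengthAt (IwasawaAlgebra p) (W.fineSelmerDualData K hγ).X
              (IwasawaAlgebra.primeT p) ≤ 1) := by
  intro hL3
  apply hD
  intro W _ _ p _ _ ha hdoor K hK γ I z₀ hγ hz hdiv
  obtain ⟨hne, hle⟩ := hL2 W p hdoor K hK γ I z₀ hγ hz
  have h2 := hL1 W p K γ I z₀ hγ hne 2 hdiv
  have h21 : ((2 : ℕ) : ℕ∞) ≤ 1 := h2.trans (hle.trans (hL3 W p ha hdoor K hK γ hγ))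
  exact absurd (by exact_mod_cast h21 : (2 : ℕ) ≤ 1) (by omega)

end Summit.BirchSwinnertonDyer.BirchSwinnertonDyer.Theorems

end
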